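import Literature.AlgebraicGeometry.Motives.AbelianVarietyBlochPolynomialMaps
import Literature.AlgebraicGeometry.Motives.AbelianVarietyTranslatedHyperplaneSections
import Literature.AlgebraicGeometry.Motives.AbelianVarietyTorsionFiniteProofs
import Literature.AlgebraicGeometry.Motives.ProjectiveNoetherNormalization
import Literature.AlgebraicGeometry.Motives.ProjectiveSpaceLinearSubspaceDegree
import Literature.AlgebraicGeometry.Motives.CyclesAbelianVarietiesProofs
import Literature.AlgebraicGeometry.Motives.VarietiesProjectiveSpaceProofs
import HarnessLib

/-!
# `Gr^l_F CH₀(A) = 0` for `l > dim A` (Voisin II, Lemma 11.30) via the theorem of the square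

For a complex abelian variety `A` of dimension `g`, the Bloch filtration
`F^l CH₀(A) = I^{⋆l}` (`AbelianVariety.blochFiltration`, `Motives/AbelianVarietyBlochFiltration`)
satisfies **`F^l CH₀(A) = F^{l+1} CH₀(A)` for every `l > g`**
(`AbelianVariety.blochFiltration_le_succ_of_dim_lt`), i.e. `Gr^l_F CH₀(A) = 0` — the conclusion of
Voisin II, Lemma 11.30, PROVED. Consequently Bloch's theorem `F^{g+1} CH₀(A) = 0` (the named fact
`Bloch1976_pontryaginPower_eq_zero`) is reduced to Voisin's Lemma 11.31 alone: `F^N CH₀(A) = 0` for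
some `N` (`Bloch1976_pontryaginPower_eq_zero_of_eventually_eq_bot`).

The printed proof of Lemma 11.30 (hard Lefschetz through a complete-intersection curve: `l!` kills
`Gr^l_F`) is replaced by the following argument, all of whose inputs are theorems of the tree:

1. `P(x) = c₁(t_x^*𝒪_A(1))^g ∩ [A] ∈ CH₀(A)` (`AbelianVariety.transCycle`; the operators
   `c₁(t_x^*𝒪_A(1)) ∩ -` of `Motives/AbelianVarietyTranslatedHyperplaneSections`) is a polynomial
   map of degree `≤ g` in `x ∈ A(ℂ)` for the group law (`blochVanishing_transCycle`): each operator
   obeys the square law (the theorem of the square, Mumford §6 Cor. 4), and a `g`-fold composite of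
   affine operators is polynomial of degree `≤ g` (`blochVanishing_iterOp_const`,
   `Motives/AbelianVarietyBlochPolynomialMaps`).
2. `P(x) = t_{x⁻¹ *} P(1)` (`transCycle_eq_pushforward`: projection formula along `t_x` and
   `t_{x*}[A] = [A]`), and `P(1) = Σ n_P {P}` with `Σ n_P = deg P(1)`; so
   `x ↦ Σ n_P {P x}` is polynomial of degree `≤ g`, whence `deg P(1)` kills `Gr^l_F` for `l > g`
   (`sum_smul_blochGen_mem_blochFiltrationOf`), and `Gr^l_F` is divisible.
3. `deg P(1) = deg (c₁(𝒪_A(1))^g ∩ [A]) ≠ 0` (`degree_transCycle_one_ne_zero`): by projective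
   Noether normalisation (Görtz–Wedhorn I, Thm. 13.89; the tree's
   `CartierDivisor.IsAmple.exists_finite_surjective_linEquiv`) there is a finite surjective
   `ψ : A → ℙ^g` over `ℂ` with `ψ^*H ∼ M • H_A`, `M ≥ 1`; by the projection formula
   (Fulton Prop. 2.3 (c)) `M^g deg(c₁(𝒪_A(1))^g ∩ [A]) = deg(c₁(𝒪(1))^g ∩ ψ_*[A])`, and
   `ψ_*[A] = [K(A):K(ℙ^g)] • [ℙ^g] ≠ 0` in `CH_g(ℙ^g) ≅ ℤ` (`ProjSpace.degreeEquiv`).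

Everything is proved; the only definition is `transCycle`. No named facts (D-0026).

## References

* [VoisinHodgeII2003] C. Voisin, Hodge Theory and Complex Algebraic Geometry II, CUP 2003, §11.3.2,
  Thm. 11.29 and Lemmas 11.30–11.31.
* [Bloch1976] S. Bloch, Some elementary theorems about algebraic cycles on Abelian varieties,
  Invent. Math. 37 (1976), Thm. 0.1.
* [MumfordAV1970] D. Mumford, Abelian Varieties (1970), §6 Cor. 4.
* [Fulton1998] W. Fulton, Intersection Theory, 2nd ed. 1998, Prop. 2.3 (c), §2.5, Example 1.9.3.
* [GortzWedhorn2020] U. Görtz, T. Wedhorn, Algebraic Geometry I, 2nd ed. 2020, Thm. 13.89.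
-/

noncomputable section

universe u

open CategoryTheory AlgebraicGeometry Order
open Literature.AlgebraicGeometry.Motives.Segre Literature.AlgebraicGeometry.Motives.RatFn
open scoped BigOperators

namespace Literature.AlgebraicGeometry.Motives

/-! ### Generalities -/

section General

variable {G : Type*} [CommGroup G] {M : Type*} [AddCommGroup M]

/-- Vanishing of iterated differences is invariant under inversion of the argument. [folklore] -/
theorem BlochVanishing.comp_inv {f : G → M} {e : ℕ} (h : BlochVanishing f e) :
    BlochVanishing (fun x => f x⁻¹) e := fun u Q s hs => by
  have key : blochGen (fun x => f x⁻¹) u Q s = blochGen f u⁻¹ (fun i => (Q i)⁻¹) s := by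
    simp only [blochGen, mul_inv, Finset.prod_inv_distrib]
  rw [key]
  exact h u⁻¹ _ s hs

end General

section Cycles

variable {K : Type u} [Field K]

/-- **The degree is invariant under proper push-forward**: `deg (π_* z) = deg z` for a morphism
`π : X → Y` of proper `K`-schemes (functoriality of proper push-forward, Stacks 02R5: both are
push-forwards to `Spec K`). [cite: Fulton1998, Definition 1.4 (p. 13)] -/
theorem ChowGroup.degree_pushforward {X Y : SchemeOver K} [IsProper X.hom] [IsProper Y.hom]
    (π : X ⟶ Y) [IsProper π.left] (z : ChowGroup X.left 0) :
    ChowGroup.degree Y (ChowGroup.pushforward 0 (map_mem_ratTrivial_holds 0) π z) =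
      ChowGroup.degree X z := by
  induction z using ChowGroup.induction_on with
  | h c =>
    rw [ChowGroup.pushforward_mk, ChowGroup.degree_mk, ChowGroup.degree_mk, coe_cyclesOfDimMap]
    have e : (toSpecOver X).left = π.left ≫ (toSpecOver Y).left := by
      rw [← Over.comp_left, AbelianVariety.comp_toSpecOver_eq']
    rw [algebraicCycleMap_congr e, algebraicCycleMap_comp π.left (toSpecOver Y).left
      π.left.isClosedMap (toSpecOver Y).left.isClosedMap]

/-- `(m • D) · c - m • (D · c) ∈ Rat` (Fulton, Prop. 2.3 (b), iterated). [cite: Fulton1998, Prop. 2.3 (b) (p. 34)] -/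
theorem CartierDivisor.interCycle_nsmul_sub_mem {X : SchemeOver K} [IsIntegral X.left]
    [LocallyOfFiniteType X.hom] (D : CartierDivisor X.left) {c : AlgebraicCycle X.left ℤ} {d : ℕ}
    (hcd : c ∈ cyclesOfDim X.left (d + 1)) (hc : (Function.support c).Finite) :
    ∀ m : ℕ, (m • D).interCycle c - m • D.interCycle c ∈ ratTrivial X.left d
  | 0 => by
    rw [zero_smul, sub_zero]
    have h := ratTrivialOn_le_ratTrivial
      ((CartierDivisor.zero_smul_sameDivisor D).interCycle_sub_interCycle_mem hcd hc)
    rwa [CartierDivisor.zero_interCycle, sub_zero] at h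
  | m + 1 => by
    have h1 := ratTrivialOn_le_ratTrivial
      ((CartierDivisor.add_smul_sameDivisor D m 1).interCycle_sub_interCycle_mem hcd hc)
    have h2 := ratTrivialOn_le_ratTrivial (CartierDivisor.interCycle_add_sub_mem (m • D) ((1 : ℕ) • D) hcd hc)
    have h3 := CartierDivisor.interCycle_nsmul_sub_mem D hcd hc m
    rw [CartierDivisor.one_smul] at h2
    have key : ((m + 1) • D).interCycle c - (m + 1) • D.interCycle c =
        (((m + 1) • D).interCycle c - (m • D + (1 : ℕ) • D).interCycle c) +
          ((m • D + D).interCycle c - ((m • D).interCycle c + D.interCycle c)) +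
          ((m • D).interCycle c - m • D.interCycle c) := by
      rw [CartierDivisor.one_smul, succ_nsmul]; abel
    rw [key]
    exact add_mem (add_mem h1 h2) h3

/-- `dim ℙ^d_K = d`: the generic point of `ℙ^d` has height `d`. [folklore] -/
theorem ProjSpace.height_genericPoint_eq (d : ℕ) :
    height (genericPoint ↥(projectiveSpace d K).left) = (d : ℕ∞) := by
  haveI := (isSmoothProjective_projectiveSpace_holds K d).smoothOfRelativeDimension
  have hsum := height_add_coheight_eq_of_smoothOfRelativeDimension (projectiveSpace d K).hom d
    (⊤ : ↥(projectiveSpace d K).left)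
  rw [coheight_top, add_zero] at hsum
  exact hsum

/-- Points of the same (finite) dimension as their image have non-zero push-forward weight
`[κ(x) : κ(f x)]` (dimension formula in the fibre, Stacks 02JW; cf.
`ProjFamily.mapCoeff_ne_zero_of_height_eq` of `Motives/LinesGenerateChowOneRational`, re-derived to
keep that import out). [cite: StacksProject, Tag 02JW] -/
theorem mapCoeff_ne_zero_of_height_eq' {X Y : Scheme.{u}} (f : X ⟶ Y)
    (q : Y ⟶ Spec (CommRingCat.of K)) [LocallyOfFiniteType f] [LocallyOfFiniteType q] (x : X)
    {n : ℕ} (hx : height x = n) (hfx : height (f.base x) = n) :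
    AlgebraicCycle.mapCoeff f height height x ≠ 0 := by
  rw [mapCoeff_height_eq_residueDegree f q x]
  apply residueDegree_ne_zero_of_height_asFiber_eq_zero
  have h := Scheme.height_eq_height_add_height_asFiber f q x
  rw [hx, hfx] at h
  have h' : (n : ℕ∞) + height (f.asFiber x) = n + 0 := by rw [add_zero]; exact h.symm
  exact ENat.add_right_injective_of_ne_top (ENat.coe_ne_top n) h'

end Cycles

/-! ### The polynomial `0`-cycle `P(x) = c₁(t_x^*𝒪_A(1))^g ∩ [A]` -/

namespace AbelianVariety

open ProjSpace CartierDivisor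

variable {A : AbelianVariety ℂ}
variable {d : ℕ} (j : A.X ⟶ projectiveSpace d ℂ) [IsClosedImmersion j.left]
  {ℓ : MvPolynomial (Fin (d + 1)) ℂ} (hℓ : ℓ ∈ grading (Fin (d + 1)) ℂ 1) (hℓ0 : ℓ ≠ 0)
  (hX : (formDivisor ℓ hℓ hℓ0).Avoids (j.left (genericPoint A.X.left)))

attribute [local instance] isProper_toSchemeHom

/-- **`P(x) = c₁(t_x^*𝒪_A(1))^g ∩ [A] ∈ CH₀(A)`**, the `g`-fold (`g = dim A`) composite of the
translated hyperplane-section operators applied to the fundamental class. [folklore] -/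
def transCycle (x : A.Points ℂ) : ChowGroup A.X.left 0 :=
  iterOp (fun n => ChowGroup A.X.left n) (transHypOp j hℓ hℓ0 hX x) A.dim A.fundamentalClass

/-- Push-forward along `t_x` through the ladder: `t_{x*}(c₁(t_x^*𝒪(1))^k ∩ a) = c₁(𝒪(1))^k ∩ t_{x*} a`
(projection formula at each step, `pushforward_transHypOp`). [cite: Fulton1998, Prop. 2.3 (c) (p. 34)] -/
theorem pushforward_iterOp_transHypOp (x : A.Points ℂ) :
    ∀ (k : ℕ) (a : ChowGroup A.X.left k),
      ChowGroup.pushforward 0 (map_mem_ratTrivial_holds 0) (A.translation x)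
          (iterOp (fun n => ChowGroup A.X.left n) (transHypOp j hℓ hℓ0 hX x) k a) =
        iterOp (fun n => ChowGroup A.X.left n) (transHypOp j hℓ hℓ0 hX 1) k
          (ChowGroup.pushforward k (map_mem_ratTrivial_holds k) (A.translation x) a)
  | 0, a => rfl
  | k + 1, a => by
    rw [iterOp_succ, iterOp_succ, pushforward_iterOp_transHypOp x k, pushforward_transHypOp]

/-- **`P(x) = t_{x⁻¹ *} P(1)`.** [folklore] -/
theorem transCycle_eq_pushforward (x : A.Points ℂ) :
    transCycle j hℓ hℓ0 hX x =
      ChowGroup.pushforward 0 (map_mem_ratTrivial_holds 0) (A.translation x⁻¹)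
        (transCycle j hℓ hℓ0 hX 1) := by
  have h := pushforward_iterOp_transHypOp j hℓ hℓ0 hX x A.dim A.fundamentalClass
  rw [pushforward_translation_fundamentalClass] at h
  rw [transCycle, transCycle, ← h, pushforward_translation_inv_comp]

/-- **`x ↦ P(x)` is polynomial of degree `≤ g`**: its `(g+1)`-fold finite differences vanish
(square law `transHypOp_mul_add` and the multi-affine expansion `blochVanishing_iterOp_const`).
[cite: MumfordAV1970, §6 Cor. 4] -/
theorem blochVanishing_transCycle :
    BlochVanishing (fun x => transCycle j hℓ hℓ0 hX x) (A.dim + 1) :=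
  blochVanishing_iterOp_const (C := fun n => ChowGroup A.X.left n)
    (fun x n => transHypOp j hℓ hℓ0 hX x n) (fun x y n => transHypOp_mul_add j hℓ hℓ0 hX x y n)
    A.dim A.fundamentalClass

/-- **The polynomial `0`-cycle in expanded form**: `P(1) = Σ_{P ∈ J} n_P {P}` with
`Σ n_P = deg P(1)`, and `x ↦ Σ n_P {P x}` has vanishing `(g+1)`-fold differences
(`P(x⁻¹) = t_{x*} P(1) = Σ n_P {x P}`). [folklore] -/
theorem exists_blochVanishing_sum_pointClass :
    ∃ (J : Finset (A.Points ℂ)) (n : A.Points ℂ → ℤ),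
      ∑ P ∈ J, n P = ChowGroup.degree A.X (transCycle j hℓ hℓ0 hX 1) ∧
        BlochVanishing (fun x => ∑ P ∈ J, n P • A.pointClass (P * x)) (A.dim + 1) := by
  obtain ⟨J, n, hz, hdeg⟩ := A.exists_eq_sum_pointClass (transCycle j hℓ hℓ0 hX 1)
  refine ⟨J, n, hdeg.symm, ?_⟩
  have h := (blochVanishing_transCycle j hℓ hℓ0 hX).comp_inv
  convert h using 1
  funext x
  rw [transCycle_eq_pushforward, inv_inv, hz, map_sum]
  refine Finset.sum_congr rfl fun P _ => ?_
  rw [map_zsmul, pushforward_translation_pointClass, mul_comm]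

/-! ### `deg P(1) = deg (c₁(𝒪_A(1))^g ∩ [A]) ≠ 0` by projective Noether normalisation -/

/-- **`H_A = V₊(ℓ)|_A` is ample** (pull-back of the ample `𝒪(1)` along the affine closed immersion
`j`, Görtz–Wedhorn I, Prop. 13.66 (2); `CartierDivisor.IsAmple.pullbackAvoiding`).
[cite: GortzWedhorn2020, Prop. 13.66 (2) (p. 509)] -/
theorem isAmple_hypDiv : (hypDiv j hℓ hℓ0 hX).IsAmple :=
  CartierDivisor.IsAmple.pullbackAvoiding j.left hX
    ((hyperplane_linEquiv_formDivisor hℓ hℓ0).isAmple isAmple_hyperplane)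

/-- **Projective Noether normalisation of `A` with linear-equivalence control** (Görtz–Wedhorn I,
Thm. 13.89; the tree's `CartierDivisor.IsAmple.exists_finite_surjective_linEquiv` for the ample
`H_A`): a finite surjective `π : A → ℙ^{dim A}` over `ℂ` with `π^* H ∼ M • H_A`, `M ≥ 1`.
[cite: GortzWedhorn2020, Thm. 13.89 (p. 519)] -/
theorem exists_finite_linEquiv_smul_hypDiv :
    ∃ (M : ℕ) (π : A.X ⟶ projectiveSpace A.dim ℂ) (hπ : IsDominant π.left), 0 < M ∧
      IsFinite π.left ∧
        (@CartierDivisor.pullback _ _ (hyperplane A.dim ℂ) A.X.left _ π.left hπ).LinEquiv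
          (M • hypDiv j hℓ hℓ0 hX) := by
  haveI : IsProper (A.X.left ↘ Spec (.of ℂ)) := A.isProper
  obtain ⟨n₀, hn₀⟩ := (isAmple_hypDiv j hℓ hℓ0 hX).exists_finite_surjective_linEquiv (K := ℂ)
  obtain ⟨c, ψ, hψfin, hψsurj, hψover, hlin⟩ :=
    hn₀ 2 one_lt_two (n₀ + 1) (Nat.le_succ _) (Nat.succ_pos _)
  haveI := hψsurj
  exact ⟨(n₀ + 1) * 2 ^ c, Over.homMk ψ hψover, (show IsDominant ψ from inferInstance),
    Nat.mul_pos (Nat.succ_pos _) (Nat.pow_pos two_pos), hψfin, hlin⟩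

/-- The operator `M • (c₁(𝒪_A(1)) ∩ -) : CH_{n+1}(A) → CH_n(A)`. [folklore] -/
def scaledOp (M : ℕ) (n : ℕ) : ChowGroup A.X.left (n + 1) →+ ChowGroup A.X.left n :=
  (DistribSMul.toAddMonoidHom (ChowGroup A.X.left n) M).comp (transHypOp j hℓ hℓ0 hX 1 n)

/-- Unfolding: `scaledOp M n z = M • (c₁(𝒪_A(1)) ∩ z)`. [folklore] -/
theorem scaledOp_apply (M : ℕ) (n : ℕ) (z : ChowGroup A.X.left (n + 1)) :
    scaledOp j hℓ hℓ0 hX M n z = M • transHypOp j hℓ hℓ0 hX 1 n z := rfl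

/-- **`M • (c₁(𝒪_A(1)) ∩ [c]) = [π^*H · c]`** when `π^*H ∼ M • H_A` (Fulton Def. 2.3 and
Prop. 2.3 (b): `D · α` depends only on the class of `D` and is additive in `D`).
[cite: Fulton1998, Prop. 2.3 (b) (p. 34)] -/
theorem scaledOp_mk (π : A.X ⟶ projectiveSpace A.dim ℂ) [IsDominant π.left] {M : ℕ}
    (hlin : (CartierDivisor.pullback (X := (projectiveSpace A.dim ℂ).left) (hyperplane A.dim ℂ) π.left).LinEquiv (M • hypDiv j hℓ hℓ0 hX)) (n : ℕ)
    (c : ↥(cyclesOfDim A.X.left (n + 1))) :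
    scaledOp j hℓ hℓ0 hX M n (ChowGroup.mk A.X.left (n + 1) c) =
      ChowGroup.mk A.X.left n ⟨(CartierDivisor.pullback (X := (projectiveSpace A.dim ℂ).left) (hyperplane A.dim ℂ) π.left).interCycle c,
        interCycle_mem_cyclesOfDim _ c.2⟩ := by
  set H := hypDiv j hℓ hℓ0 hX with hH
  set E := CartierDivisor.pullback (X := (projectiveSpace A.dim ℂ).left) (hyperplane A.dim ℂ) π.left with hE
  have hfin := finite_support_of_compactSpace (c : AlgebraicCycle A.X.left ℤ)
  rw [scaledOp_apply, transHypOp_mk, ← map_nsmul, ChowGroup.mk_eq_mk_iff]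
  change M • (H.pullback (A.translation 1).left).interCycle c - E.interCycle c ∈ ratTrivial A.X.left n
  have h1 := ratTrivialOn_le_ratTrivial
    ((pullback_translation_one_sameDivisor j hℓ hℓ0 hX).interCycle_sub_interCycle_mem c.2 hfin)
  have h1' : M • (H.pullback (A.translation 1).left).interCycle c - M • H.interCycle c ∈
      ratTrivial A.X.left n := by
    simpa only [smul_sub] using AddSubgroup.nsmul_mem _ h1 M
  have h2 := CartierDivisor.interCycle_nsmul_sub_mem H c.2 hfin M
  have h3 := ratTrivialOn_le_ratTrivial (hlin.interCycle_sub_interCycle_mem c.2 hfin)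
  have key : M • (H.pullback (A.translation 1).left).interCycle c - E.interCycle c =
      (M • (H.pullback (A.translation 1).left).interCycle c - M • H.interCycle c) +
        -((M • H).interCycle c - M • H.interCycle c) + -(E.interCycle c - (M • H).interCycle c) := by
    abel
  rw [key]
  exact add_mem (add_mem h1' (neg_mem h2)) (neg_mem h3)

/-- **Projection formula along `π`** (Fulton Prop. 2.3 (c), the tree's
`CartierDivisor.map_interCycle_pullback_sub_mem`): `π_*(M • c₁(𝒪_A(1)) ∩ z) = c₁(𝒪(1)) ∩ π_* z`.
[cite: Fulton1998, Prop. 2.3 (c) (p. 34)] -/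
theorem pushforward_scaledOp (π : A.X ⟶ projectiveSpace A.dim ℂ) [IsDominant π.left]
    [IsFinite π.left] {M : ℕ}
    (hlin : (CartierDivisor.pullback (X := (projectiveSpace A.dim ℂ).left) (hyperplane A.dim ℂ) π.left).LinEquiv (M • hypDiv j hℓ hℓ0 hX)) (n : ℕ)
    (z : ChowGroup A.X.left (n + 1)) :
    ChowGroup.pushforward n (map_mem_ratTrivial_holds n) π (scaledOp j hℓ hℓ0 hX M n z) =
      hyperplaneSection A.dim ℂ n
        (ChowGroup.pushforward (n + 1) (map_mem_ratTrivial_holds (n + 1)) π z) := by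
  induction z using ChowGroup.induction_on with
  | h c =>
    have hfin := finite_support_of_compactSpace (c : AlgebraicCycle A.X.left ℤ)
    rw [scaledOp_mk j hℓ hℓ0 hX π hlin, ChowGroup.pushforward_mk, ChowGroup.pushforward_mk,
      hyperplaneSection_mk, ChowGroup.mk_eq_mk_iff]
    exact ratTrivialOn_le_ratTrivial
      (CartierDivisor.map_interCycle_pullback_sub_mem π (hyperplane A.dim ℂ) c.2 hfin)

/-- Iterating: `π_*((M • c₁(𝒪_A(1)))^k ∩ a) = c₁(𝒪(1))^k ∩ π_* a`. [cite: Fulton1998, Prop. 2.3 (c) (p. 34)] -/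
theorem pushforward_iterOp_scaledOp (π : A.X ⟶ projectiveSpace A.dim ℂ) [IsDominant π.left]
    [IsFinite π.left] {M : ℕ}
    (hlin : (CartierDivisor.pullback (X := (projectiveSpace A.dim ℂ).left) (hyperplane A.dim ℂ) π.left).LinEquiv (M • hypDiv j hℓ hℓ0 hX)) :
    ∀ (k : ℕ) (a : ChowGroup A.X.left k),
      ChowGroup.pushforward 0 (map_mem_ratTrivial_holds 0) π
          (iterOp (fun n => ChowGroup A.X.left n) (scaledOp j hℓ hℓ0 hX M) k a) =
        hyperplaneSectionToZero A.dim k (ChowGroup.pushforward k (map_mem_ratTrivial_holds k) π a)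
  | 0, a => rfl
  | k + 1, a => by
    rw [iterOp_succ, pushforward_iterOp_scaledOp π hlin k, pushforward_scaledOp j hℓ hℓ0 hX π hlin,
      hyperplaneSectionToZero_succ]

/-- `(M • c₁(𝒪_A(1)))^k ∩ a = M^k • (c₁(𝒪_A(1))^k ∩ a)`. [folklore] -/
theorem iterOp_scaledOp_eq (M : ℕ) :
    ∀ (k : ℕ) (a : ChowGroup A.X.left k),
      iterOp (fun n => ChowGroup A.X.left n) (scaledOp j hℓ hℓ0 hX M) k a =
        M ^ k • iterOp (fun n => ChowGroup A.X.left n) (transHypOp j hℓ hℓ0 hX 1) k a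
  | 0, a => by simp
  | k + 1, a => by
    rw [iterOp_succ, iterOp_succ, iterOp_scaledOp_eq M k, scaledOp_apply, map_nsmul, _root_.smul_smul,
      ← pow_succ]

omit [IsClosedImmersion j.left] in
/-- **`deg (c₁(𝒪(1))^g ∩ π_*[A]) ≠ 0` on `ℙ^g`**: `π_*[A] = [K(A) : K(ℙ^g)] • [ℙ^g]` with a non-zero
coefficient (`π` generically finite: equal dimensions), `Rat_g(ℙ^g) = 0`, and
`deg ∘ (c₁(𝒪(1))^g ∩ -)` is injective on `CH_g(ℙ^g) ≅ ℤ` (Fulton, Example 1.9.3 and §2.5).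
[cite: Fulton1998, Example 1.9.3 (p. 23) and §2.5 (p. 41)] -/
theorem degree_hyperplaneSectionToZero_pushforward_fundamentalClass_ne_zero
    (π : A.X ⟶ projectiveSpace A.dim ℂ) [IsDominant π.left] [IsFinite π.left] :
    ChowGroup.degree (projectiveSpace A.dim ℂ) (hyperplaneSectionToZero A.dim A.dim
      (ChowGroup.pushforward A.dim (map_mem_ratTrivial_holds A.dim) π A.fundamentalClass)) ≠ 0 := by
  classical
  haveI := irreducibleSpace_left A
  intro h0
  have hinj := (degree_comp_hyperplaneSectionToZero_bijective (N := A.dim) (K := ℂ) le_rfl).1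
  have hzero : ChowGroup.pushforward A.dim (map_mem_ratTrivial_holds A.dim) π A.fundamentalClass = 0 :=
    (injective_iff_map_eq_zero _).1 hinj _ h0
  rw [fundamentalClass, ChowGroup.ofPoint, ChowGroup.pushforward_mk] at hzero
  have hmk := (isSmoothProjective_projectiveSpace_holds ℂ A.dim).chowGroup_mk_injective
  have hc := congrArg Subtype.val (hmk (hzero.trans (map_zero _).symm))
  rw [coe_cyclesOfDimMap, algebraicCycleMap_primeCycle_eq_nsmul] at hc
  have hr := congrArg (fun f : AlgebraicCycle (projectiveSpace A.dim ℂ).left ℤ =>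
    f (π.left.base (genericPoint A.X.left))) hc
  simp [primeCycle_apply_self] at hr
  have hgen : π.left.base (genericPoint A.X.left) = genericPoint ↥(projectiveSpace A.dim ℂ).left :=
    RatFn.genericPoint_eq_of_isDominant π.left
  have hne := mapCoeff_ne_zero_of_height_eq' π.left (projectiveSpace A.dim ℂ).hom
    (genericPoint A.X.left) A.height_genericPoint_eq_dim
    (by rw [hgen]; exact ProjSpace.height_genericPoint_eq A.dim)
  exact hne (by exact_mod_cast hr)

/-- **`deg P(1) = deg (c₁(𝒪_A(1))^g ∩ [A]) ≠ 0`**: with `π : A → ℙ^g` finite surjective and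
`π^*H ∼ M • H_A`, `M^g • deg(c₁(𝒪_A(1))^g ∩ [A]) = deg(c₁(𝒪(1))^g ∩ π_*[A]) ≠ 0`.
[cite: GortzWedhorn2020, Thm. 13.89 (p. 519)] [cite: Fulton1998, Prop. 2.3 (c) (p. 34)] -/
theorem degree_transCycle_one_ne_zero : ChowGroup.degree A.X (transCycle j hℓ hℓ0 hX 1) ≠ 0 := by
  obtain ⟨M, π, hπdom, -, hπfin, hlin⟩ := exists_finite_linEquiv_smul_hypDiv j hℓ hℓ0 hX
  haveI := hπdom
  haveI := hπfin
  have h1 : iterOp (fun n => ChowGroup A.X.left n) (scaledOp j hℓ hℓ0 hX M) A.dim A.fundamentalClass =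
      M ^ A.dim • transCycle j hℓ hℓ0 hX 1 :=
    iterOp_scaledOp_eq j hℓ hℓ0 hX M A.dim A.fundamentalClass
  have h2 := pushforward_iterOp_scaledOp j hℓ hℓ0 hX π hlin A.dim A.fundamentalClass
  have h3 := degree_hyperplaneSectionToZero_pushforward_fundamentalClass_ne_zero (A := A) π
  rw [← h2, ChowGroup.degree_pushforward, h1, map_nsmul] at h3
  intro h0
  exact h3 (by rw [h0, smul_zero])

end AbelianVariety

/-! ### `Gr^l_F CH₀(A) = 0` for `l > dim A`, and Bloch's theorem from Lemma 11.31 alone -/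

/-- **Voisin II, Lemma 11.30 (conclusion), PROVED: `F^l CH₀(A) = F^{l+1} CH₀(A)` for every
`l > dim A`**, i.e. `Gr^l_F CH₀(A) = 0` for `l > g` (printed: "`Gr^i_F CH₀(A)` is annihilated by
`i!` … as it is clearly a divisible group, it must be trivial"). Proof here: the `0`-cycle
`z = c₁(𝒪_A(1))^g ∩ [A] = Σ n_P {P}` has `deg z ≠ 0` (`degree_transCycle_one_ne_zero`) and is
polynomial of degree `≤ g` under translation (theorem of the square,
`exists_blochVanishing_sum_pointClass`), so `deg z` kills `Gr^l_F` for `l > g`, which is divisible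
(`AbelianVariety.blochFiltration_le_succ_of_blochVanishing`). [cite: VoisinHodgeII2003, Lemma 11.30] -/
theorem AbelianVariety.blochFiltration_le_succ_of_dim_lt (A : AbelianVariety ℂ) {l : ℕ}
    (hl : A.dim < l) : A.blochFiltration l ≤ A.blochFiltration (l + 1) := by
  obtain ⟨d, j, hj⟩ : IsProjectiveOver A.X := AbelianVariety.isProjectiveOver_holds (k := ℂ) A
  haveI := hj
  obtain ⟨i, hXi⟩ := ProjSpace.exists_formDivisor_avoids_genericPoint j
  obtain ⟨J, n, hsum, hvan⟩ := AbelianVariety.exists_blochVanishing_sum_pointClass j (X_mem ℂ i)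
    (MvPolynomial.X_ne_zero i) hXi
  refine A.blochFiltration_le_succ_of_blochVanishing J n ?_ hvan hl
  rw [hsum]
  exact AbelianVariety.degree_transCycle_one_ne_zero j _ _ hXi

/-- **Bloch's theorem reduced to Voisin II, Lemma 11.31.** If `F^N CH₀(A) = 0` for some `N` for
every complex abelian variety `A` (Lemma 11.31: `A` is a quotient of a Jacobian `J(C)` and
`F^{g(C)+1} CH₀(J(C)) = 0`, Lemmas 11.32–11.33), then the named fact
`Bloch1976_pontryaginPower_eq_zero` (`F^{dim A + 1} CH₀(A) = 0`, Bloch 1976 Thm. 0.1 / Voisin II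
Thm. 11.29) holds: Lemma 11.30 is `AbelianVariety.blochFiltration_le_succ_of_dim_lt` and the
assembly is `Bloch1976_pontryaginPower_eq_zero_of_voisin`.
[cite: VoisinHodgeII2003, Thm. 11.29 (proof)] -/
theorem Bloch1976_pontryaginPower_eq_zero_of_eventually_eq_bot
    (h31 : ∀ A : AbelianVariety ℂ, ∃ N, A.blochFiltration N = ⊥) :
    Bloch1976_pontryaginPower_eq_zero :=
  Bloch1976_pontryaginPower_eq_zero_of_voisin
    (fun A _ hl => A.blochFiltration_le_succ_of_dim_lt hl) h31

end Literature.AlgebraicGeometry.Motives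

end
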